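import Summits.QuantumFields.YangMills.Theses.ParabolicTrajectory

/-!
# Route ParabolicTrajectory — Assembly (item stmt-QuantumFields-9178)

The assembly item of route `route-QuantumFields-ParabolicTrajectory` is the pure-logic glue
`ContinuumLimitOnTrajectory → LatticeGapOnTrajectory → TunedSequenceExists → YangMills`.
The route file already carries the planner-authored deciding theorem
`Summit.QuantumFields.YangMills.Theses.ParabolicTrajectory.closes` of literally this type
(fix `G`; a lattice representation `r` from `IsCompactSimpleLieGroup G`; block factor
`M := max M₀ 2`; tuning window `θ := min θ₀ θ₁ / 2`; the tuned scheme from (S); the gap `Δ` and the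
gap-transfer clause from (B); the renormalised scheme `sch'` (same `a`, `β`, `L`) and OS data `T`
from (A); `HasLatticeMassGap r sch' Δ` is `HasLatticeMassGap r sch Δ` rewritten along the three
equalities).  This file closes the item by citing it.
-/

namespace Summit.QuantumFields.YangMills.Theorems

/-- **Assembly of route ParabolicTrajectory** (item stmt-QuantumFields-9178):
`ContinuumLimitOnTrajectory → LatticeGapOnTrajectory → TunedSequenceExists → YangMills`,
i.e. the three cruxes (A) continuum limit on the trajectory, (B) lattice gap on the trajectory and
(S) existence of tuned sequences together imply the Clay statement `YangMills`.  Proof: the route's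
deciding theorem `ParabolicTrajectory.closes` has exactly this type. -/
theorem Assembly_proof : Summit.QuantumFields.YangMills.Theses.ParabolicTrajectory.Assembly := by
  unfold Summit.QuantumFields.YangMills.Theses.ParabolicTrajectory.Assembly
  exact Summit.QuantumFields.YangMills.Theses.ParabolicTrajectory.closes

end Summit.QuantumFields.YangMills.Theorems
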